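import Literature.AlgebraicGeometry.Hu2025.Statements.S05ThetaBlowups.R106cThetaBlowups
import Mathlib.RingTheory.Ideal.Quotient.Basic

/-!
# Hu 2025 (arXiv:2507.21400v1), §5.4: Def. 5.14, Prop. 5.16 (= what joint J3 / G-H2 reads for `Ṽ`; v5: «Furthermore» weak + full reading; v6: `Φ.IsStandard →` guards on Prop. 5.16 / Cor. 5.17 per lane-B N106-5), Cor. 5.17, Cor. 5.18,
# Def. 5.19, Rem. 5.20 — file `S05ThetaBlowups/R106dThetaEquations.lean` of row 106 (FILED by res-type-023 (gen 9) as row-106 owner per the M-Hu re-pointing line 2026-08-27T08:00:07Z (director-resolution g4, M-Hu-min OPEN; REPOINT LIST OF RECORD res-dag-1 04:27Z); T9: every locator re-read on the chunks in this seat 2026-08-27T05:4xZ; pre-drafts g4–g9 under HOME/plan/tools/res-type-023/hu/). Items ↦ decls, frame dictionary, reading/sic notes: module docstring of `R106bThetaFrame`. Source status and tags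
# as there: `[claim: Hu2025, status: under-review]` — «STATUS: candidate statement under adjudication (D-0012/D-0089); not asserted».
-/

noncomputable section

open MvPolynomial

namespace Literature.AlgebraicGeometry.Hu2025.Statements.S05ThetaBlowups

universe u v

namespace ThetaFrame

variable {P : Type v} {Rs : Type v} [DecidableEq P] [DecidableEq Rs]
variable (Φ : ThetaFrame P Rs)

section WithRing

variable (R : Type u) [CommRing R]

/-! ### Def. 5.14 — the pieces `𝓑^gov_{𝔙,<k}`, `𝓑^ngv_{𝔙,<k}`, `L_{𝔙,<k}`, `𝓑^gov_{𝔙,>k}`, `𝓑^ngv_{𝔙,>k}`, `L_{𝔙,>k}` -/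

/-- **Definition 5.14 (C38L77–L88; p.89), `𝓑^gov_{𝔙,<k}`:** «We let 𝓑^gov_{<k} … be the set of all governing … relations
corresponding to F < F_k … Then, upon restricting the above to a fixed standard chart 𝔙, we obtain 𝓑^gov_{𝔙,<k}, …» — the
Def. 5.13 transforms on the chart (`c`, level `k`) of the governing binomials of the blocks `F_{j'}`, `j' < j` (`j` = the printed
`F_k`).
[claim: Hu2025, status: under-review]
STATUS: candidate statement under adjudication (D-0012/D-0089); not asserted. -/
def BgovLT (c : Φ.Chart) (k : ℕ) (j : Fin Φ.N) : Set (MvPolynomial (P ⊕ Rs) R) :=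
  {f | ∃ (j' : Fin Φ.N) (τ : Fin (Φ.t j')), j' < j ∧ f = (Φ.govAt c k j' τ).toPoly (R := R)}

/-- **Definition 5.14, `𝓑^gov_{𝔙,>k}`** (C38L81–L83 «𝓑^gov_{>k} (resp. …) be the set of all main [sic: governing] … relations
corresponding to F > F_k»).
[claim: Hu2025, status: under-review]
STATUS: candidate statement under adjudication (D-0012/D-0089); not asserted. -/
def BgovGT (c : Φ.Chart) (k : ℕ) (j : Fin Φ.N) : Set (MvPolynomial (P ⊕ Rs) R) :=
  {f | ∃ (j' : Fin Φ.N) (τ : Fin (Φ.t j')), j < j' ∧ f = (Φ.govAt c k j' τ).toPoly (R := R)}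

/-- **Definition 5.14, `𝓑^ngv_{𝔙,>k}`** (C38L81–L83 «non-governing binomials of ϱ-degree 1 … corresponding to F > F_k»).
[claim: Hu2025, status: under-review]
STATUS: candidate statement under adjudication (D-0012/D-0089); not asserted. -/
def BngvGT (c : Φ.Chart) (k : ℕ) (j : Fin Φ.N) : Set (MvPolynomial (P ⊕ Rs) R) :=
  {f | ∃ (j' : Fin Φ.N) (τ τ' : Fin (Φ.t j')), j < j' ∧ τ ≠ τ' ∧ f = (Φ.ngvAt c k j' τ τ').toPoly (R := R)}

/-- **Definition 5.14, `𝓑^ngv_{𝔙,<k}`** (C38L79–L81 «𝓑^ngv_{<k} … the set of all … non-governing binomials of ϱ-degree 1 …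
corresponding to F < F_k»). Typed for completeness of the printed six families (lane-A row Def5_14, res-ref-a10 2026-08-27T10:20Z);
Prop. 5.16 does not use it («discard the non-governing relations in 𝓑^ngv_{≤k}», C39L105–L106).
[claim: Hu2025, status: under-review]
STATUS: candidate statement under adjudication (D-0012/D-0089); not asserted. -/
def BngvLT (c : Φ.Chart) (k : ℕ) (j : Fin Φ.N) : Set (MvPolynomial (P ⊕ Rs) R) :=
  {f | ∃ (j' : Fin Φ.N) (τ τ' : Fin (Φ.t j')), j' < j ∧ τ ≠ τ' ∧ f = (Φ.ngvAt c k j' τ τ').toPoly (R := R)}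

/-- **Definition 5.14, `L_{𝔙,<k}`** (C38L79–L81 «or linear ℘ relations corresponding to F < F_k»).
[claim: Hu2025, status: under-review]
STATUS: candidate statement under adjudication (D-0012/D-0089); not asserted. -/
def LinLT (c : Φ.Chart) (k : ℕ) (j : Fin Φ.N) : Set (MvPolynomial (P ⊕ Rs) R) :=
  {f | ∃ j' : Fin Φ.N, j' < j ∧ f = Φ.linAt R c k j'}

/-- **Definition 5.14, `𝓛_{𝔙,>k}`** (C38L81–L83).
[claim: Hu2025, status: under-review]
STATUS: candidate statement under adjudication (D-0012/D-0089); not asserted. -/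
def LinGT (c : Φ.Chart) (k : ℕ) (j : Fin Φ.N) : Set (MvPolynomial (P ⊕ Rs) R) :=
  {f | ∃ j' : Fin Φ.N, j < j' ∧ f = Φ.linAt R c k j'}

/-- **Definition 5.14 under its printed name:** the SIX restricted families on the chart of `ℛ̃_{ϑ[k]}` given by `c`, relative
to the block `F_j` (C38L77–L88; p.89), in the printed order — `(𝓑^gov_{𝔙,<k}, 𝓑^ngv_{𝔙,<k}, L_{𝔙,<k}, 𝓑^gov_{𝔙,>k}, 𝓑^ngv_{𝔙,>k},
𝓛_{𝔙,>k})` (l.78–80 / l.81–83); the `≤`/`≥` variants are the unions with the `F_j`-block. (rev 2: `𝓑^ngv_{𝔙,<k}` added per lane-A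
row, res-ref-a10 2026-08-27T10:20Z — rev 1 listed five.)
[claim: Hu2025, status: under-review]
STATUS: candidate statement under adjudication (D-0012/D-0089); not asserted. -/
def _root_.Literature.AlgebraicGeometry.Hu2025.Statements.S05ThetaBlowups.Def5_14
    (Φ : ThetaFrame P Rs) (R : Type u) [CommRing R] (c : Φ.Chart) (k : ℕ) (j : Fin Φ.N) :
    Set (MvPolynomial (P ⊕ Rs) R) × Set (MvPolynomial (P ⊕ Rs) R) × Set (MvPolynomial (P ⊕ Rs) R) ×
      Set (MvPolynomial (P ⊕ Rs) R) × Set (MvPolynomial (P ⊕ Rs) R) × Set (MvPolynomial (P ⊕ Rs) R) :=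
  (Φ.BgovLT R c k j, Φ.BngvLT R c k j, Φ.LinLT R c k j, Φ.BgovGT R c k j, Φ.BngvGT R c k j, Φ.LinGT R c k j)

/-! ### Prop. 5.16 — the displayed equations on a chart of `ℛ̃_{ϑ[k]}` and the statement -/

/-- **Prop. 5.16, the displayed governing binomials of the block `F_k` on the chart `𝔙` of `ℛ̃_{ϑ[k]}` (printed `k` = `j+1`).**
Case (A) `(m,u_k) ∈ Λ^o` or `𝔙` ϱ-standard (C38L128–L129), display C38L137–L139: «B_{𝔙,(s_{F_k},s)}: x_{𝔙,(u_s,v_s)} x_{𝔙,u_k} −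
x̃_{𝔙,u_s} x̃_{𝔙,v_s}, ∀ s ∈ S_{F_k} ∖ s_{F_k}»; case (B) `(m,u_k) ∉ Λ^o` and `𝔙` ϖ-standard (C38L153), display C39L4–L6:
«B_{𝔙,(s_{F_k},s)}: x_{𝔙,(u_s,v_s)} − x_{𝔙,(m,u_k)} x̃_{𝔙,u_s} x̃_{𝔙,v_s}», «where x̃_{𝔙,u_s} = π^*_{𝔙,𝔙_[0]} x_{𝔙_[0],u_s} …»
(C38L147–L151 / C39L14–L17). On the fixed index type `x_{𝔙,(u_s,v_s)}`, `x_{𝔙,u_k}`, `x_{𝔙,(m,u_k)}` are the variables of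
those indices (`xOpt` = 1 for the chart's `≡ 1` coordinate). (Why `x_{𝔙,(u_s,v_s)}` is still a plain variable of `𝔙`: by the standing
facts (iv) a non-leading ϱ-coordinate is never a leading one, hence never in `𝔡_𝔙` nor in a ϑ-centre — kernel: `ThetaFrame.dispGov_eq_govAt`
in `Proofs/…/Disp516.lean`; lane-B pre-read N3 2026-08-27T06:53Z.)
[claim: Hu2025, status: under-review]
STATUS: candidate statement under adjudication (D-0012/D-0089); not asserted. -/
def _root_.Literature.AlgebraicGeometry.Hu2025.Statements.S05ThetaBlowups.Prop5_16_dispGov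
    (Φ : ThetaFrame P Rs) (R : Type u) [CommRing R] (c : Φ.Chart) (j : Fin Φ.N) (τ : Fin (Φ.t j)) :
    MvPolynomial (P ⊕ Rs) R :=
  (Φ.lead j).elim
    -- case (A), sub-case (m,u_k) ∈ Λ^o
    (xOpt R (Φ.termR j τ) * X (Sum.inl (Φ.ult j)) -
      Φ.xTilde R c (j + 1) (Φ.termP₁ j τ) * Φ.xTilde R c (j + 1) (Φ.termP₂ j τ))
    fun r => (c j).by
      -- case (B): ϖ-standard chart
      (xOpt R (Φ.termR j τ) -
        X (Sum.inr r) * Φ.xTilde R c (j + 1) (Φ.termP₁ j τ) * Φ.xTilde R c (j + 1) (Φ.termP₂ j τ))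
      -- case (A), sub-case ϱ-standard chart
      (xOpt R (Φ.termR j τ) * X (Sum.inl (Φ.ult j)) -
        Φ.xTilde R c (j + 1) (Φ.termP₁ j τ) * Φ.xTilde R c (j + 1) (Φ.termP₂ j τ))

/-- **Prop. 5.16, the displayed linearized relation of the block `F_k` on the chart `𝔙` of `ℛ̃_{ϑ[k]}`.** Case (A), display
C38L140–L141: «L_{𝔙,F_k}: sgn(s_F) δ_{𝔙,(m,u_k)} + Σ_{s ∈ S_F ∖ s_F} sgn(s) x_{𝔙,(u_s,v_s)}» (in the sub-case `(m,u_k) ∈ Λ^o`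
there is no `δ` and the coordinate is `≡ 1` — typed `xOpt (lead k)`, see the module's sic notes); case (B), display C39L7–L8:
«L_{𝔙,F_k}: sgn(s_F) ε_{𝔙,u_k} x_{𝔙,(m,u_k)} + Σ_{s ∈ S_F ∖ s_F} sgn(s) x_{𝔙,(u_s,v_s)}».
[claim: Hu2025, status: under-review]
STATUS: candidate statement under adjudication (D-0012/D-0089); not asserted. -/
def _root_.Literature.AlgebraicGeometry.Hu2025.Statements.S05ThetaBlowups.Prop5_16_dispLin
    (Φ : ThetaFrame P Rs) (R : Type u) [CommRing R] (c : Φ.Chart) (j : Fin Φ.N) : MvPolynomial (P ⊕ Rs) R :=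
  (Φ.lead j).elim
    -- case (A), sub-case (m,u_k) ∈ Λ^o: the leading coordinate is ≡ 1
    (Φ.sgnLead j • (1 : MvPolynomial (P ⊕ Rs) R) + ∑ τ : Fin (Φ.t j), Φ.sgnTerm j τ • xOpt R (Φ.termR j τ))
    fun r => (c j).by
      -- case (B): ϖ-standard chart, «sgn(s_F) ε_{𝔙,u_k} x_{𝔙,(m,u_k)}»
      (Φ.sgnLead j • (X (Sum.inl (Φ.ult j)) * X (Sum.inr r)) +
        ∑ τ : Fin (Φ.t j), Φ.sgnTerm j τ • xOpt R (Φ.termR j τ))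
      -- case (A), ϱ-standard chart, «sgn(s_F) δ_{𝔙,(m,u_k)}»
      (Φ.sgnLead j • X (Sum.inr r) + ∑ τ : Fin (Φ.t j), Φ.sgnTerm j τ • xOpt R (Φ.termR j τ))

/-- **Prop. 5.16, the LIST of defining relations of `Ṽ_{ϑ[k]} ∩ 𝔙` (eqnarrays C38L134–L145 case (A), C39L1–L12 case (B)):**
«𝓑^𝔯𝔟_𝔙, 𝓑^gov_{𝔙,<k}, 𝓛_{𝔙,<k}, B_{𝔙,(s_{F_k},s)} (displayed) ∀ s ∈ S_{F_k} ∖ s_{F_k}, L_{𝔙,F_k} (displayed), 𝓑^gov_{𝔙,>k},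
𝓑^ngv_{𝔙,>k}, 𝓛_{𝔙,>k}» — the non-governing binomials of the blocks `≤ k` are NOT in the list (C39L105–L106 «The above allows us
to discard the non-governing relations in 𝓑^ngv_{≤k} on the chart 𝔙»). Chart of `ℛ̃_{ϑ[k]}`: word `c`, level `j+1`.
[claim: Hu2025, status: under-review]
STATUS: candidate statement under adjudication (D-0012/D-0089); not asserted. -/
def equationsAt (c : Φ.Chart) (j : Fin Φ.N) : Set (MvPolynomial (P ⊕ Rs) R) :=
  (Binomial.toPoly (R := R) '' Φ.rbAt c (j + 1)) ∪ Φ.BgovLT R c (j + 1) j ∪ Φ.LinLT R c (j + 1) j ∪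
    Set.range (Prop5_16_dispGov Φ R c j) ∪ {Prop5_16_dispLin Φ R c j} ∪
    Φ.BgovGT R c (j + 1) j ∪ Φ.BngvGT R c (j + 1) j ∪ Φ.LinGT R c (j + 1) j

/-- «ϱ-linear» for a monomial (exponent vector) on a chart over `𝔙_[0]` (Def. 4.3 ‹chunk 4.2› C21L116–L120 «A multi-homogeneous
polynomial f ∈ R_[k] is ϱ-linear if it is linear in [x_{(u_s,v_s)}]_{s ∈ S_{F_i}}, whenever it contains some ϱ-variables of ℙ_{F_i},
for any i ∈ [k]»; used by Prop. 5.16 C39L19–L25, Cor. 5.17 C40L101): chart-level reading — in every block `F_i` the total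
degree in the ϱ-variables of that block is ≤ 1 (de-homogenised; dictionary res-type-024 `IsRhoLinear`).
[claim: Hu2025, status: under-review]
STATUS: candidate statement under adjudication (D-0012/D-0089); not asserted. -/
def IsRhoLinearExp (T : (P ⊕ Rs) →₀ ℕ) : Prop :=
  ∀ i : Fin Φ.N,
    (∑ x ∈ T.support, Sum.elim (fun _ => (0 : ℕ)) (fun r => if Φ.blk r = i then T (Sum.inr r) else 0) x) ≤ 1

/-- «ϱ-linear» for a binomial: both terms are (Prop. 5.16 C39L19–L20 «B_𝔙 is ϱ-linear and square-free»).
[claim: Hu2025, status: under-review]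
STATUS: candidate statement under adjudication (D-0012/D-0089); not asserted. -/
def IsRhoLinearB (B : Binomial (P ⊕ Rs)) : Prop := Φ.IsRhoLinearExp B.plus ∧ Φ.IsRhoLinearExp B.minus

/-- The number of ϑ-exceptional parameters (`ε_{𝔙,u}`, `u ∈ 𝔢_𝔙`, and `δ_{𝔙,(m,u)}`, `(m,u) ∈ 𝔡_𝔙`) in a monomial of the chart,
counted with multiplicity (Prop. 5.16 C39L25–L26 «admits at most one (counting multiplicity) ϑ-exceptional parameter»).
[claim: Hu2025, status: under-review]
STATUS: candidate statement under adjudication (D-0012/D-0089); not asserted. -/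
def excCount (c : Φ.Chart) (k : ℕ) (T : (P ⊕ Rs) →₀ ℕ) : ℕ :=
  ∑ u ∈ Φ.eSet c k, T (Sum.inl u) + ∑ r ∈ Φ.dSet c k, T (Sum.inr r)

/-- **Proposition 5.16, defining relations (statement C38L124–C39L17, proof C39L40–C40L58; p.89–92) — what joint J3 (G-H2)
reads for `Ṽ`.** «We keep the notation and assumptions in Proposition (meaning-of-var-vtk). Suppose (m,u_k) ∈ Λ^o_[k] or 𝔙 is a
ϱ-standard chart. Then, we have that the scheme Ṽ_{ϑ[k]} ∩ 𝔙, as a closed subscheme of the chart 𝔙 of ℛ̃_{ϑ[k]}, is defined by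
[the list (A)] … Suppose (m,u_k) ∉ Λ^o_[k] and 𝔙 is a ϖ-standard chart. Then … is defined by [the list (B)]». Typed, for every
word `c` and every block index `j` (printed `k = j+1`): the chart ideal of `Ṽ_{ϑ[k]} ∩ 𝔙` (`idealVTilde`, OURS carrier = iterated
strict transform of `idealV0`) EQUALS the ideal generated by the listed relations (`equationsAt`, whose displayed members already
distinguish the cases (A)/(B)). Printed proof, inductive step (C39L77–L81, C40L34–L37): «By applying the inductive assumption to
𝔙', it suffices to prove that on the chart 𝔙, the proper transform of any non-governing binomial with respect to F_k depends on
the governing binomials with respect to F_k» — i.e. it takes the equations of `Ṽ_{ϑ[k]} ∩ 𝔙` to be the term-wise proper transforms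
of those of `Ṽ_{ϑ[k−1]} ∩ 𝔙'` (Def. 5.4 vs `Def5_4_ours`). Stated under the standing facts `Φ.IsStandard` of the frame (the print keeps «the notation and assumptions in Proposition 5.11», C38L125–L126 / C40L92; T4; lane-B pre-read N106-5 2026-08-27T07:17Z — without them e.g. `Prop5_16_2` is refutable on a non-standard frame).
[claim: Hu2025, status: under-review]
STATUS: candidate statement under adjudication (D-0012/D-0089); not asserted. -/
def _root_.Literature.AlgebraicGeometry.Hu2025.Statements.S05ThetaBlowups.Prop5_16_1
    (Φ : ThetaFrame P Rs) (R : Type u) [CommRing R] : Prop :=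
  Φ.IsStandard → ∀ (c : Φ.Chart) (j : Fin Φ.N), Φ.idealVTilde R c (j + 1) = Ideal.span (Φ.equationsAt R c j)

/-- **Proposition 5.16, «Moreover» (C39L19–L20; p.90):** «for any binomial B ∈ 𝓑^gov ⊔ 𝓑^ngv_{>k}, B_𝔙 is ϱ-linear and
square-free» (on every standard chart `𝔙` of `ℛ̃_{ϑ[k]}`; chart-level readings `IsRhoLinearB`, `Binomial.IsSquareFree`). Stated under the standing facts `Φ.IsStandard` of the frame (the print keeps «the notation and assumptions in Proposition 5.11», C38L125–L126 / C40L92; T4; lane-B pre-read N106-5 2026-08-27T07:17Z — without them e.g. `Prop5_16_2` is refutable on a non-standard frame).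
[claim: Hu2025, status: under-review]
STATUS: candidate statement under adjudication (D-0012/D-0089); not asserted. -/
def _root_.Literature.AlgebraicGeometry.Hu2025.Statements.S05ThetaBlowups.Prop5_16_2
    (Φ : ThetaFrame P Rs) : Prop :=
  Φ.IsStandard → ∀ (c : Φ.Chart) (j : Fin Φ.N) (B : Binomial (P ⊕ Rs)),
    (B ∈ Φ.Bgov0 ∨ ∃ (j' : Fin Φ.N) (τ τ' : Fin (Φ.t j')), j < j' ∧ τ ≠ τ' ∧ B = Φ.ngv0 j' τ τ') →
    Φ.IsRhoLinearB (Φ.transformB c (j + 1) B) ∧ (Φ.transformB c (j + 1) B).IsSquareFree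

/-- **Proposition 5.16, «Furthermore» (C39L22–L38; p.90) — WEAK READING, NAMED AS SUCH (`_weak`): the unconditional part of
the clause.** «Furthermore, consider an arbitrary binomial B ∈ 𝓑^𝔯𝔟 and its proper transform B_𝔙 on the chart 𝔙. Let T_{𝔙,B} be any
fixed term of B_𝔙. Then, T_{𝔙,B} is ϱ-linear and admits at most one (counting multiplicity) ϑ-exceptional parameter in the form of
[…] In particular, B_𝔙 is square-free.» Typed: each term of `B_𝔙` is ϱ-linear, carries at most one ϑ-exceptional parameter counted
with multiplicity (`excCount ≤ 1`), and `B_𝔙` is square-free. NOT ENCODED HERE: the «in the form of …» clauses and the parentheticals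
«(hence u ∈ 𝕀^{lt,0})» — they are typed, under an explicit reading, in `Prop5_16_3` (lane-A pre-read res-ref-a10 2026-08-27T05:35:49Z:
«rename … _weak … or encode the form clauses» — both done). Stated under the standing facts `Φ.IsStandard` of the frame (the print keeps «the notation and assumptions in Proposition 5.11», C38L125–L126 / C40L92; T4; lane-B pre-read N106-5 2026-08-27T07:17Z — without them e.g. `Prop5_16_2` is refutable on a non-standard frame).
[claim: Hu2025, status: under-review]
STATUS: candidate statement under adjudication (D-0012/D-0089); not asserted — WEAK reading (form clauses omitted). -/
def _root_.Literature.AlgebraicGeometry.Hu2025.Statements.S05ThetaBlowups.Prop5_16_3_weak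
    (Φ : ThetaFrame P Rs) : Prop :=
  Φ.IsStandard → ∀ (c : Φ.Chart) (j : Fin Φ.N) (B : Binomial (P ⊕ Rs)), B ∈ Φ.rb →
    (Φ.IsRhoLinearExp (Φ.transformB c (j + 1) B).plus ∧ Φ.excCount c (j + 1) (Φ.transformB c (j + 1) B).plus ≤ 1) ∧
    (Φ.IsRhoLinearExp (Φ.transformB c (j + 1) B).minus ∧ Φ.excCount c (j + 1) (Φ.transformB c (j + 1) B).minus ≤ 1) ∧
    (Φ.transformB c (j + 1) B).IsSquareFree

/-- **Prop. 5.16 «Furthermore», the «in the form of» clauses for ONE pair of corresponding terms (C39L25–L37; p.90) — typed under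
the READING stated here (the printed quantifier scope «for some … if T_{𝔙,B} contains …» is resolved by us; the lanes judge it).**
Printed: «T_{𝔙,B} … admits at most one (counting multiplicity) ϑ-exceptional parameter in the form of δ_{𝔙,(m,u)} for some
(m,u) ∈ 𝔡_𝔙 or ε_{𝔙,u} x_{𝔙,(m,u)} for some u ∈ 𝔢_𝔙, if T_{𝔙,B} contains x_{𝔙,(m,u)} (hence u ∈ 𝕀^{lt,0}_{3,n}); or ε_{𝔙,u} for some
u ∈ 𝔢_𝔙 or δ_{𝔙,(m,u)} x_{𝔙,u} for some (m,u) ∈ 𝔡_𝔙, if T_{𝔙,B} contains x_{𝔙,u} (hence u ∈ 𝕀^{lt,0}_{3,n}).» READING (OURS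
disambiguation, recorded for the INDEX): `T` = the term of `B` on `𝔙_[0]` corresponding to the term `T'` of `B_𝔙` (plus ↔ plus,
minus ↔ minus); a ϑ-exceptional parameter occurring in `T'` is attached to a block `F_i` — it is `ε_{𝔙,u_i}` (`u_i ∈ 𝔢_𝔙`) or
`δ_{𝔙,(m,u_i)}` (`(m,u_i) ∈ 𝔡_𝔙`); «T contains x_{(m,u)}» resp. «x_u» = the coordinate `x_{(m,u_i)}` resp. `x_{u_i}` occurs in `T`
(the ϑ-steps of the other blocks do not touch these two coordinates, so `𝔙_[0]` or `𝔙'` give the same reading). The clause then says,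
for every such parameter: `u_i ∈ 𝕀^{lt,0}` («hence»; the rank-0 predicate on ϖ-indices, (Ilt0) C20L60–L65, is the parameter
`isRankZeroVar` as in `Def5_7_termLT`), and EITHER `T` contains `x_{(m,u_i)}` and the parameter occurs as `δ_{𝔙,(m,u_i)}` or as
`ε_{𝔙,u_i}` together with `x_{𝔙,(m,u_i)}` in `T'`, OR `T` contains `x_{u_i}` and it occurs as `ε_{𝔙,u_i}` or as `δ_{𝔙,(m,u_i)}`
together with `x_{𝔙,u_i}` in `T'`. (On the fixed index type: a ϖ-step at `F_i` substitutes `x_{(m,u_i)} ↦ ε_{u_i}·x_{(m,u_i)}` and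
renames `x_{u_i} ↦ ε_{u_i}`; a ϱ-step substitutes `x_{u_i} ↦ δ_{(m,u_i)}·x_{u_i}` and renames `x_{(m,u_i)} ↦ δ_{(m,u_i)}` —
C37L141–L150, C38L11–L20 — which is where the four printed forms come from.)
[claim: Hu2025, status: under-review]
STATUS: candidate statement under adjudication (D-0012/D-0089); not asserted — READING of the printed form clauses (OURS disambiguation). -/
def FormClauses (isRankZeroVar : P → Bool) (c : Φ.Chart) (k : ℕ) (T T' : (P ⊕ Rs) →₀ ℕ) : Prop :=
  (∀ i : Fin Φ.N, Φ.ult i ∈ Φ.eSet c k → 1 ≤ T' (Sum.inl (Φ.ult i)) →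
      isRankZeroVar (Φ.ult i) = true ∧
        ((∃ r, Φ.lead i = some r ∧ 1 ≤ T (Sum.inr r) ∧ 1 ≤ T' (Sum.inr r)) ∨ 1 ≤ T (Sum.inl (Φ.ult i)))) ∧
  (∀ (i : Fin Φ.N) (r : Rs), Φ.lead i = some r → r ∈ Φ.dSet c k → 1 ≤ T' (Sum.inr r) →
      isRankZeroVar (Φ.ult i) = true ∧
        (1 ≤ T (Sum.inr r) ∨ (1 ≤ T (Sum.inl (Φ.ult i)) ∧ 1 ≤ T' (Sum.inl (Φ.ult i)))))

/-- **Proposition 5.16, «Furthermore» (C39L22–L38; p.90), the WHOLE clause:** `Prop5_16_3_weak` (ϱ-linear, at most one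
ϑ-exceptional parameter counting multiplicity, square-free) AND the «in the form of» / «hence u ∈ 𝕀^{lt,0}» clauses for both terms
under the READING of `ThetaFrame.FormClauses` (see there; the rank-0 predicate `isRankZeroVar` on ϖ-indices is a parameter, rows
101/102). Stated under the standing facts `Φ.IsStandard` of the frame (the print keeps «the notation and assumptions in Proposition 5.11», C38L125–L126 / C40L92; T4; lane-B pre-read N106-5 2026-08-27T07:17Z — without them e.g. `Prop5_16_2` is refutable on a non-standard frame).
[claim: Hu2025, status: under-review]
STATUS: candidate statement under adjudication (D-0012/D-0089); not asserted — the form clauses under a recorded READING. -/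
def _root_.Literature.AlgebraicGeometry.Hu2025.Statements.S05ThetaBlowups.Prop5_16_3
    (Φ : ThetaFrame P Rs) (isRankZeroVar : P → Bool) : Prop :=
  Prop5_16_3_weak Φ ∧
    (Φ.IsStandard → ∀ (c : Φ.Chart) (j : Fin Φ.N) (B : Binomial (P ⊕ Rs)), B ∈ Φ.rb →
      Φ.FormClauses isRankZeroVar c (j + 1) B.plus (Φ.transformB c (j + 1) B).plus ∧
        Φ.FormClauses isRankZeroVar c (j + 1) B.minus (Φ.transformB c (j + 1) B).minus)

/-- **Proposition 5.16 (C38L124–C39L38; p.89–90), the whole statement:** conjunction of `Prop5_16_1` (defining relations, both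
chart types), `Prop5_16_2` («Moreover»), `Prop5_16_3` («Furthermore», form clauses under the READING of `ThetaFrame.FormClauses`).
The sibling `Prop5_16_weak` replaces the third conjunct by `Prop5_16_3_weak`. Each conjunct carries the guard `Φ.IsStandard →` (standing
facts of the frame, C38L125–L126; lane-B pre-read N106-5).
[claim: Hu2025, status: under-review]
STATUS: candidate statement under adjudication (D-0012/D-0089); not asserted. -/
def _root_.Literature.AlgebraicGeometry.Hu2025.Statements.S05ThetaBlowups.Prop5_16
    (Φ : ThetaFrame P Rs) (R : Type u) [CommRing R] (isRankZeroVar : P → Bool) : Prop :=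
  Prop5_16_1 Φ R ∧ Prop5_16_2 Φ ∧ Prop5_16_3 Φ isRankZeroVar

/-- **Proposition 5.16 (C38L124–C39L38; p.89–90), WEAK sibling (named as such):** `Prop5_16_1 ∧ Prop5_16_2 ∧ Prop5_16_3_weak` — the statement without the
«in the form of» clauses of the «Furthermore» part (everything Cor. 5.17 quotes: ϱ-linear and square-free); each conjunct guarded by
`Φ.IsStandard →`.
[claim: Hu2025, status: under-review]
STATUS: candidate statement under adjudication (D-0012/D-0089); not asserted — WEAK reading (form clauses omitted). -/
def _root_.Literature.AlgebraicGeometry.Hu2025.Statements.S05ThetaBlowups.Prop5_16_weak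
    (Φ : ThetaFrame P Rs) (R : Type u) [CommRing R] : Prop :=
  Prop5_16_1 Φ R ∧ Prop5_16_2 Φ ∧ Prop5_16_3_weak Φ

/-! ### Cor. 5.17, Cor. 5.18, Def. 5.19, Rem. 5.20 — the final stage `ℛ̃_ϑ := ℛ̃_{ϑ[Υ]}`, `Ṽ_ϑ := Ṽ_{ϑ[Υ]}` (C40L87–L89) -/

/-- **Corollary 5.17 (C40L91–L101; p.93).** «Let the notation be as in Proposition (equas-fV[k]) for k = Υ. Then, the scheme
Ṽ_ϑ ∩ 𝔙, as a closed subscheme of the chart 𝔙 of ℛ̃_ϑ = ℛ̃_{ϑ[Υ]}, is defined by 𝓑^gov_𝔙, L_{𝔉,𝔙}, 𝓑^𝔯𝔟_𝔙, where the first two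
sets make of all governing relations. Further, for any binomial B_𝔙 ∈ 𝓑^gov_𝔙 ∪ 𝓑^𝔯𝔟_𝔙, it is ϱ-linear and square-free.» Typed on
every word `c` at level `Υ`, with the Def. 5.13 transforms. Stated under the standing facts `Φ.IsStandard` of the frame (the print keeps «the notation and assumptions in Proposition 5.11», C38L125–L126 / C40L92; T4; lane-B pre-read N106-5 2026-08-27T07:17Z).
[claim: Hu2025, status: under-review]
STATUS: candidate statement under adjudication (D-0012/D-0089); not asserted. -/
def _root_.Literature.AlgebraicGeometry.Hu2025.Statements.S05ThetaBlowups.Cor5_17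
    (Φ : ThetaFrame P Rs) (R : Type u) [CommRing R] : Prop :=
  Φ.IsStandard → ∀ c : Φ.Chart,
    Φ.idealVTilde R c Φ.N =
      Ideal.span
        ((Binomial.toPoly (R := R) '' Φ.rbAt c Φ.N) ∪
          {f | ∃ (j : Fin Φ.N) (τ : Fin (Φ.t j)), f = (Φ.govAt c Φ.N j τ).toPoly (R := R)} ∪
          Set.range (Φ.linAt R c Φ.N)) ∧
    ∀ B : Binomial (P ⊕ Rs), B ∈ Φ.Bgov0 ∪ Φ.rb →
      Φ.IsRhoLinearB (Φ.transformB c Φ.N B) ∧ (Φ.transformB c Φ.N B).IsSquareFree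

/-- **Corollary 5.18, first statement in its chart form (C40L103–L111; p.93).** «Fix any k ∈ [Υ]. Let X_{ϑ,(m,u_k)} be the proper
transform of X_{(m,u_k)} in ℛ̃_ϑ. Then Ṽ_ϑ ∩ X_{ϑ,(m,u_k)} = ∅. Put it differently, on any chart 𝔙 of ℛ̃_ϑ, x_{𝔙,(m,u_k)} is invertible
as long as it is a variable in Var_𝔙.» Typed (second sentence): on every word `c` at level `Υ`, if `(m,u_k)` is a variable of
`𝔙_[0]` (`lead k = some r`) and still a variable of `𝔙` (`r ∉ 𝔡_𝔙`), then `x_{(m,u_k)}` is a unit modulo the ideal of `Ṽ_ϑ ∩ 𝔙`.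
Stated under the standing facts `Φ.IsStandard` of the frame (v3; hypotheses explicit, T4).
[claim: Hu2025, status: under-review]
STATUS: candidate statement under adjudication (D-0012/D-0089); not asserted. -/
def _root_.Literature.AlgebraicGeometry.Hu2025.Statements.S05ThetaBlowups.Cor5_18
    (Φ : ThetaFrame P Rs) (R : Type u) [CommRing R] : Prop :=
  Φ.IsStandard → ∀ (c : Φ.Chart) (k : Fin Φ.N) (r : Rs), Φ.lead k = some r → r ∉ Φ.dSet c Φ.N →
    IsUnit (Ideal.Quotient.mk (Φ.idealVTilde R c Φ.N) (X (Sum.inr r)))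

/-- **Definition 5.19 (C40L145–L147; p.94) with Cor. 5.18's description (C40L111–L115):** «We call any standard chart of ℛ̃_ϑ as
described by Corollary (no-(um,uu)) a preferred standard chart» — «the standard charts that either lie over the chart
(x_{(m,u_k)} ≡ 1) of ℛ or lie over the ϱ-standard chart of ℛ̃_{ϑ[k]}», for every `k`. Typed on words: at every position either
`(m,u_k) ∈ Λ^o` or the choice is `varrho`.
[claim: Hu2025, status: under-review]
STATUS: candidate statement under adjudication (D-0012/D-0089); not asserted. -/
def IsPreferred (c : Φ.Chart) : Prop := ∀ k : Fin Φ.N, Φ.lead k = none ∨ c k = ThetaKind.varrho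

/-- **Definition 5.19 under its printed name (C40L145–L147; p.94):** `Def5_19 Φ c` = «the standard chart of `ℛ̃_ϑ` recorded by
`c` is preferred». Alias of `ThetaFrame.IsPreferred`.
[claim: Hu2025, status: under-review]
STATUS: candidate statement under adjudication (D-0012/D-0089); not asserted. -/
abbrev _root_.Literature.AlgebraicGeometry.Hu2025.Statements.S05ThetaBlowups.Def5_19
    (Φ : ThetaFrame P Rs) (c : Φ.Chart) : Prop := Φ.IsPreferred c

/-- **Corollary 5.18, «In particular» (C40L111–L115; p.93) — PARTIAL (chart-local form).** «the scheme Ṽ_ϑ is covered by the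
standard charts that either lie over the chart (x_{(m,u_k)} ≡ 1) of ℛ or lie over the ϱ-standard chart of ℛ̃_{ϑ[k]}» — i.e. by the
preferred charts (Def. 5.19). A covering statement is not chart-local; its chart-local content (Rem. 5.20: on a ϖ-standard chart
`x_{(m,u_k)}` is invertible along `Ṽ`, so `Ṽ ∩ 𝔙` lies in the overlap with the ϱ-standard chart) is typed: for every word `c` and
every position `k` where `c` is NOT preferred, `x_{(m,u_k)}` is a unit modulo the ideal of `Ṽ_ϑ ∩ 𝔙_c`. Stated under the standing
facts `Φ.IsStandard` of the frame (v3; hypotheses explicit, T4).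
[claim: Hu2025, status: under-review]
STATUS: candidate statement under adjudication (D-0012/D-0089); not asserted — PARTIAL (chart-local) reading. -/
def _root_.Literature.AlgebraicGeometry.Hu2025.Statements.S05ThetaBlowups.Cor5_18_cover
    (Φ : ThetaFrame P Rs) (R : Type u) [CommRing R] : Prop :=
  Φ.IsStandard → ∀ (c : Φ.Chart) (k : Fin Φ.N) (r : Rs), Φ.lead k = some r → c k = ThetaKind.varpi →
    IsUnit (Ideal.Quotient.mk (Φ.idealVTilde R c Φ.N) (X (Sum.inr r)))

/-- **Remark 5.20, first two sentences (C41L1–L2; p.94):** «On ϖ-standard charts, x_{𝔙_{ϑ[k]},(m,u_k)} is an invertible variable.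
Thus, all ϖ-standard charts miss the divisor X_{ϑ,(m,u_k)}.» Read along `Ṽ_ϑ` (as in Cor. 5.18, whose proof C40L128–L142 it
summarises: «x_{𝔙_{ϑ[k]},(m,u_k)} is nowhere vanishing along Ṽ_{ϑ[k]} ∩ 𝔙»): the same Prop as `Cor5_18_cover`.
[claim: Hu2025, status: under-review]
STATUS: candidate statement under adjudication (D-0012/D-0089); not asserted. -/
def _root_.Literature.AlgebraicGeometry.Hu2025.Statements.S05ThetaBlowups.Rem5_20_1
    (Φ : ThetaFrame P Rs) (R : Type u) [CommRing R] : Prop :=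
  Cor5_18_cover Φ R

/-- **Remark 5.20, last sentences (C41L3–L4; p.94):** «On the other hand, on ϱ-standard charts, x_{𝔙_{ϑ[k]},(m,u_k)} is not a variable,
instead, δ_{𝔙_{ϑ[k]},(m,u_k)} is. We choose to work with the latter.» Typed: on a ϱ-standard chart at position `k` the index
`(m,u_k)` is labelled (belongs to `𝔡_𝔙`) — definitional bookkeeping, recorded for the INDEX.
[claim: Hu2025, status: under-review]
STATUS: candidate statement under adjudication (D-0012/D-0089); not asserted. -/
def _root_.Literature.AlgebraicGeometry.Hu2025.Statements.S05ThetaBlowups.Rem5_20_2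
    (Φ : ThetaFrame P Rs) : Prop :=
  ∀ (c : Φ.Chart) (k : Fin Φ.N) (r : Rs), Φ.lead k = some r → c k = ThetaKind.varrho → r ∈ Φ.dSet c (k + 1)

end WithRing

end ThetaFrame

end Literature.AlgebraicGeometry.Hu2025.Statements.S05ThetaBlowups

end
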